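import Summits.HodgeConjecture.HodgeConjecture.Theorems.CorCMDomination
import Literature.AlgebraicGeometry.Milne1999.CodesHCOfCMHodgeHypothesis
import Literature.AlgebraicGeometry.Motives.AbelianVarietyIsoOfScheme
import HarnessLib

/-!
# COR-CM model layer (model-2), M14 part 2: every CODED CM product — and every complex abelian variety
# of CM type — is dominated by a product `∏_j A_{(F, Θ_j)}` over ONE CM field `F`

Continuation of `CorCMDomination` (the domination calculus and the inflation leaf). Over a FIXED CM field
`F` into which every leaf field embeds (`LeafEmbeddable F v`), this file proves by induction over the
product tree of a CM-flagged code `v : PicardCM.Var` (stage-1 index type; CM codes and binary products)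
that any abelian variety `B` with `B.X = PicardCM.Var.scheme hU h₃ v` is `AVDominatedBy` the left-nested
product `cmProdAV h₃ F n Θ = ∏_{j ≤ n} A_{(F, Θ_j)}` of the CHOSEN realisations of the codes
`cmCode F (Θ j)` (= the stage-1 model's `U.cmAV F (Θ j)`, read unbundled) — `coded_avDominatedBy`; and
then, with CM domination by realised codes up to isogeny (the tree's `hDom_of_hSimple`: Poincaré complete
reducibility (kernel) + the binders `Shimura1998_Thm2_Cor`, `hSimple`), that EVERY complex abelian
variety of CM type is so dominated — `avDominatedBy_cmProd_of_isOfCMType` — which is the M14 content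
for the iso-complete universe `universe₂` (whose CM predicate is `∃ A, IsOfCMType A ∧ A.X ≅ scheme v`).
The accumulator form of the induction (second conjunct of `coded_avDominatedBy`) avoids re-associating
iterated products: only the binary associator is used.

Binders: `hd : Shimura1998_Thm3_isogenousPower`, `hcor : Shimura1998_Thm2_Cor` (leaf, via
`avDominatedBy_of_inducedCMType`); `hSimple` (only for arbitrary CM abelian varieties). The common field
`F` is a PARAMETER here (its existence with `F` Galois of degree `≥ 6` is the companion lemma).
-/

noncomputable section

open CategoryTheory CategoryTheory.Limits NumberField
open Literature.AlgebraicGeometry.Motives Literature.AlgebraicGeometry.HodgeTheory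
open Literature.AlgebraicGeometry.ComplexMultiplication
open Literature.AlgebraicGeometry.Milne1999
open Literature.NumberTheory.ComplexMultiplication (inducedCMType mem_inducedCMType_iff inducedCMType_comp)
open Literature.NumberTheory.Automorphic
open Literature.NumberTheory.Automorphic.PicardCM (CMCode cmRealisation BallQuotientUniformisedDatum
  CMAbelianVarietyRealised)

namespace Summit.HodgeConjecture.CorCM.Domination

/-! ### The chosen CM codes of an (unbundled) CM field and the left-nested CM products -/

section Codes

variable (F : Type) [Field F] [NumberField F] [IsCMField F]

/-- A fixed complex embedding of `F` (= stage-1 PKG `Model.cmEmb`, unbundled). [folklore] -/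
def cmEmb : F →+* ℂ := Classical.arbitrary (F →+* ℂ)

/-- The CM code of `(F, Φ)` at the fixed embedding (= stage-1 PKG `Model.cmCode`, unbundled). [folklore] -/
def cmCode (Φ : CMType F) : CMCode := CMCode.ofCMType (cmEmb F) Φ

/-- `F ≃+* (cmCode F Φ).E`. [folklore] -/
def cmCodeEquiv (Φ : CMType F) : F ≃+* (cmCode F Φ).E := (cmEmb F).rangeRestrictFieldEquiv

variable (h₃ : CMAbelianVarietyRealised)

/-- **The left-nested product `∏_{j ≤ n} A_{(F, Θ_j)}`** of the chosen realisations of the codes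
`cmCode F (Θ j)`, as an ABELIAN VARIETY (its underlying scheme is, definitionally, the stage-1 model's
`U.cmProd F Θ`). [folklore] -/
def cmProdAV : (n : ℕ) → (Fin (n + 1) → CMType F) → AbelianVariety ℂ
  | 0, Θ => (cmRealisation h₃ (cmCode F (Θ 0))).AV
  | n + 1, Θ => (cmProdAV n (fun i => Θ i.castSucc)).prod (cmRealisation h₃ (cmCode F (Θ (Fin.last (n + 1))))).AV

/-- Unfolding of `cmProdAV` at `0`. [folklore] -/
theorem cmProdAV_zero (Θ : Fin 1 → CMType F) :
    cmProdAV F h₃ 0 Θ = (cmRealisation h₃ (cmCode F (Θ 0))).AV := rfl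

/-- Unfolding of `cmProdAV` at a successor. [folklore] -/
theorem cmProdAV_succ (n : ℕ) (Θ : Fin (n + 2) → CMType F) :
    cmProdAV F h₃ (n + 1) Θ =
      (cmProdAV F h₃ n (fun i => Θ i.castSucc)).prod
        (cmRealisation h₃ (cmCode F (Θ (Fin.last (n + 1))))).AV := rfl

/-- Appending one factor: `cmProdAV (n+1) (snoc Θ Ψ) = cmProdAV n Θ × A_{(F,Ψ)}`. [folklore] -/
theorem cmProdAV_snoc (n : ℕ) (Θ : Fin (n + 1) → CMType F) (Ψ : CMType F) :
    cmProdAV F h₃ (n + 1) (Fin.snoc Θ Ψ) =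
      (cmProdAV F h₃ n Θ).prod (cmRealisation h₃ (cmCode F Ψ)).AV := by
  rw [cmProdAV_succ]
  have h1 : (fun i : Fin (n + 1) => (Fin.snoc Θ Ψ : Fin (n + 2) → CMType F) i.castSucc) = Θ :=
    funext fun i => Fin.snoc_castSucc (α := fun _ => CMType F) (x := Ψ) (p := Θ) i
  rw [h1, Fin.snoc_last]

end Codes

/-! ### The inflation leaf, on codes -/

/-- **Leaf on codes.** The chosen realisation `A_c` of a CM code `c = (E ⊂ ℂ, Φ)` is dominated by the
chosen realisation of the code of `(F, Φ^F)` for every embedding `k : E → F` into a CM field `F`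
(`avDominatedBy_of_inducedCMType`, the two realisations read on the code fields `E` and
`(cmCode F Φ^F).E ≅ F`). [cite: Shimura1998, §6.2 Theorem 3 and §6.1 Corollary of Theorem 2 (pp. 41–43)] -/
theorem avDominatedBy_inflate_code (hd : Shimura1998_Thm3_isogenousPower) (hcor : Shimura1998_Thm2_Cor)
    (h₃ : CMAbelianVarietyRealised) (c : CMCode)
    {F : Type} [Field F] [NumberField F] [IsCMField F] (k : c.E →+* F) :
    AVDominatedBy (cmRealisation h₃ c).AV
      (cmRealisation h₃ (cmCode F (inducedCMType k c.Φ))).AV := by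
  set Ψ : CMType F := inducedCMType k c.Φ
  let k₀ : c.E →+* (cmCode F Ψ).E := (cmCodeEquiv F Ψ).toRingHom.comp k
  have hind : inducedCMType k₀ c.Φ = (cmCode F Ψ).Φ := by
    rw [inducedCMType_comp]
    rfl
  have hA' := cmRealisation_isCMTypeRealisation h₃ (cmCode F Ψ)
  rw [← hind] at hA'
  exact avDominatedBy_of_inducedCMType hd hcor k₀ c.Φ (cmRealisation_isCMTypeRealisation h₃ c) hA'

/-! ### Auxiliary isomorphisms of binary products of abelian varieties -/

section ProdIso

variable {X Y Z Y' : AbelianVariety ℂ}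

/-- `X × –` preserves isomorphisms. [folklore] -/
def prodCongrRight (X : AbelianVariety ℂ) (e : Y ≅ Y') : X.prod Y ≅ X.prod Y' where
  hom := AbelianVariety.prodMap (𝟙 X) e.hom
  inv := AbelianVariety.prodMap (𝟙 X) e.inv
  hom_inv_id := by rw [AVDominatedBy.prodMap_comp, Category.comp_id, e.hom_inv_id, AVDominatedBy.prodMap_id_id]
  inv_hom_id := by rw [AVDominatedBy.prodMap_comp, Category.comp_id, e.inv_hom_id, AVDominatedBy.prodMap_id_id]

/-- `– × Z` preserves isomorphisms. [folklore] -/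
def prodCongrLeft (e : Y ≅ Y') (Z : AbelianVariety ℂ) : Y.prod Z ≅ Y'.prod Z where
  hom := AbelianVariety.prodMap e.hom (𝟙 Z)
  inv := AbelianVariety.prodMap e.inv (𝟙 Z)
  hom_inv_id := by rw [AVDominatedBy.prodMap_comp, Category.comp_id, e.hom_inv_id, AVDominatedBy.prodMap_id_id]
  inv_hom_id := by rw [AVDominatedBy.prodMap_comp, Category.comp_id, e.inv_hom_id, AVDominatedBy.prodMap_id_id]

/-- The associator `X × (Y × Z) ≅ (X × Y) × Z`. [folklore] -/
def prodAssoc (X Y Z : AbelianVariety ℂ) : X.prod (Y.prod Z) ≅ (X.prod Y).prod Z where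
  hom := AbelianVariety.prodLift
    (AbelianVariety.prodLift (AbelianVariety.fst X _) (AbelianVariety.snd X _ ≫ AbelianVariety.fst Y Z))
    (AbelianVariety.snd X _ ≫ AbelianVariety.snd Y Z)
  inv := AbelianVariety.prodLift (AbelianVariety.fst _ Z ≫ AbelianVariety.fst X Y)
    (AbelianVariety.prodLift (AbelianVariety.fst _ Z ≫ AbelianVariety.snd X Y) (AbelianVariety.snd _ Z))
  hom_inv_id := by
    apply AbelianVariety.prod_hom_ext
    · simp only [Category.assoc, AbelianVariety.prodLift_fst, Category.id_comp]
      rw [AbelianVariety.prodLift_fst_assoc, AbelianVariety.prodLift_fst]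
    · apply AbelianVariety.prod_hom_ext
      · simp only [Category.assoc, AbelianVariety.prodLift_snd, Category.id_comp]
        rw [AbelianVariety.prodLift_fst, AbelianVariety.prodLift_fst_assoc, AbelianVariety.prodLift_snd]
      · simp only [Category.assoc, AbelianVariety.prodLift_snd, Category.id_comp]
  inv_hom_id := by
    apply AbelianVariety.prod_hom_ext
    · apply AbelianVariety.prod_hom_ext
      · simp only [Category.assoc, AbelianVariety.prodLift_fst, Category.id_comp]
      · simp only [Category.assoc, AbelianVariety.prodLift_fst, Category.id_comp]
        rw [AbelianVariety.prodLift_snd, AbelianVariety.prodLift_snd_assoc, AbelianVariety.prodLift_fst]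
    · simp only [Category.assoc, AbelianVariety.prodLift_snd, Category.id_comp]
      rw [AbelianVariety.prodLift_snd_assoc, AbelianVariety.prodLift_snd]

end ProdIso

/-! ### Induction over the product tree of a CM-flagged code -/

/-- **The leaf fields of a code embed into `F`** (recursively: for a CM code, an embedding of its
field into `F` exists; for a product, both factors; vacuous elsewhere). [folklore] -/
def LeafEmbeddable (F : Type) [Field F] : PicardCM.Var → Prop
  | .cm c => Nonempty (c.E →+* F)
  | .prod v w => LeafEmbeddable F v ∧ LeafEmbeddable F w
  | .pms _ => True
  | .proj _ => True

variable (hU : BallQuotientUniformisedDatum) (h₃ : CMAbelianVarietyRealised)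

/-- **Coded CM products are dominated by `∏_j A_{(F,Θ_j)}`** (with accumulator). For a CM-flagged
code `v` whose leaf fields embed into the CM field `F`, every abelian variety `B` with underlying
variety `PicardCM.Var.scheme hU h₃ v` (i) is dominated by some `cmProdAV F n Θ`, and (ii) for every
`cmProdAV F m Θ'`, the product `cmProdAV F m Θ' × B` is dominated by some `cmProdAV F n Θ`. Leaves:
`avDominatedBy_inflate_code`; products: `AVDominatedBy.prod`, the associator, and (ii) as the
induction hypothesis. [cite: Shimura1998, §6.2 Theorem 3 and §6.1 Corollary of Theorem 2 (pp. 41–43)] -/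
theorem coded_avDominatedBy (hd : Shimura1998_Thm3_isogenousPower) (hcor : Shimura1998_Thm2_Cor)
    {F : Type} [Field F] [NumberField F] [IsCMField F] :
    ∀ (v : PicardCM.Var), PicardCM.Var.IsCMAbelianVariety h₃ v → LeafEmbeddable F v →
      ∀ (B : AbelianVariety ℂ), B.X = PicardCM.Var.scheme hU h₃ v →
        (∃ (n : ℕ) (Θ : Fin (n + 1) → CMType F), AVDominatedBy B (cmProdAV F h₃ n Θ)) ∧
        (∀ (m : ℕ) (Θ' : Fin (m + 1) → CMType F),
          ∃ (n : ℕ) (Θ : Fin (n + 1) → CMType F), AVDominatedBy ((cmProdAV F h₃ m Θ').prod B) (cmProdAV F h₃ n Θ))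
  | .pms _, hv, _, _, _ => hv.elim
  | .proj _, hv, _, _, _ => hv.elim
  | .cm c, _, hF, B, hB => by
      obtain ⟨k⟩ := hF
      -- `B` and the chosen realisation share the underlying variety
      have eB : B ≅ (cmRealisation h₃ c).AV := AbelianVariety.isoOfOverIso' (eqToIso hB)
      have hleaf : AVDominatedBy B (cmRealisation h₃ (cmCode F (inducedCMType k c.Φ))).AV :=
        AVDominatedBy.of_iso eB (avDominatedBy_inflate_code hd hcor h₃ c k)
      refine ⟨⟨0, fun _ => inducedCMType k c.Φ, hleaf⟩, fun m Θ' => ?_⟩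
      refine ⟨m + 1, Fin.snoc Θ' (inducedCMType k c.Φ), ?_⟩
      rw [cmProdAV_snoc]
      exact (AVDominatedBy.refl _).prod hleaf
  | .prod v w, hv, hF, B, hB => by
      obtain ⟨B₁, hB₁, -⟩ := exists_isOfCMType_of_isCMAbelianVariety hU h₃ hv.1
      obtain ⟨B₂, hB₂, -⟩ := exists_isOfCMType_of_isCMAbelianVariety hU h₃ hv.2
      have IH₁ := coded_avDominatedBy hd hcor v hv.1 hF.1 B₁ hB₁
      have IH₂ := coded_avDominatedBy hd hcor w hv.2 hF.2 B₂ hB₂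
      have eB : B ≅ B₁.prod B₂ :=
        AbelianVariety.isoOfOverIso' (eqToIso (by rw [hB, AbelianVariety.prod_X, hB₁, hB₂]; rfl))
      constructor
      · obtain ⟨n₁, Θ₁, h₁⟩ := IH₁.1
        obtain ⟨n, Θ, h⟩ := IH₂.2 n₁ Θ₁
        exact ⟨n, Θ, (AVDominatedBy.of_iso eB (h₁.prod (AVDominatedBy.refl B₂))).trans h⟩
      · intro m Θ'
        obtain ⟨n', Θ'', h'⟩ := IH₁.2 m Θ'
        obtain ⟨n, Θ, h⟩ := IH₂.2 n' Θ''
        refine ⟨n, Θ, ?_⟩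
        have e : (cmProdAV F h₃ m Θ').prod B ≅ ((cmProdAV F h₃ m Θ').prod B₁).prod B₂ :=
          prodCongrRight _ eB ≪≫ prodAssoc _ _ _
        exact (AVDominatedBy.of_iso e (h'.prod (AVDominatedBy.refl B₂))).trans h

/-- **Coded CM products are dominated**, scheme-level form (M14's conclusion shape for the stage-1
model universe at a CM-flagged code, over a field `F` receiving the leaf fields).
[cite: Shimura1998, §6.2 Theorem 3 and §6.1 Corollary of Theorem 2 (pp. 41–43)] -/
theorem coded_isDominatedBy (hd : Shimura1998_Thm3_isogenousPower) (hcor : Shimura1998_Thm2_Cor)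
    {F : Type} [Field F] [NumberField F] [IsCMField F] (v : PicardCM.Var)
    (hv : PicardCM.Var.IsCMAbelianVariety h₃ v) (hF : LeafEmbeddable F v) :
    ∃ (n : ℕ) (Θ : Fin (n + 1) → CMType F),
      IsDominatedBy (PicardCM.Var.scheme hU h₃ v) (cmProdAV F h₃ n Θ).X := by
  obtain ⟨B, hB, -⟩ := exists_isOfCMType_of_isCMAbelianVariety hU h₃ hv
  obtain ⟨n, Θ, h⟩ := (coded_avDominatedBy hU h₃ hd hcor v hv hF B hB).1
  exact ⟨n, Θ, hB ▸ h.isDominatedBy⟩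

/-- **Every complex abelian variety of CM type is dominated by a product `∏_j A_{(F,Θ_j)}`** over any
CM field `F` receiving the leaf fields of a coded model of `A`: CM domination by realised codes up to
isogeny — the hypothesis `hDom`, verbatim the binder of the tree's
`Milne1999.forall_cmHodgeHypothesisAt_of_codesHC` and DISCHARGED there from Poincaré complete
reducibility (kernel) with `Shimura1998_Thm2_Cor` and `hSimple` (`Milne1999.hDom_of_hSimple`) —
followed by `coded_avDominatedBy` and isogeny transport. This is the M14 content at the `emb` codes of
the iso-complete universe. The field `F` is universal over fields receiving the leaf fields of the
coded model `v`; its Galois enlargement of degree `≥ 6` is the companion lemma.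
[cite: Shimura1998, §5.1 Props. 1, 3, 4 and §6.1 Corollary of Theorem 2 (p. 41)] -/
theorem avDominatedBy_cmProd_of_isOfCMType (hd : Shimura1998_Thm3_isogenousPower)
    (hcor : Shimura1998_Thm2_Cor)
    (hDom : ∀ A : AbelianVariety ℂ, IsSmoothProjective A.dim A.X → IsOfCMType A →
      ∃ (v : PicardCM.Var) (B : AbelianVariety ℂ), PicardCM.Var.IsCMAbelianVariety h₃ v ∧
        B.X = PicardCM.Var.scheme hU h₃ v ∧ AbelianVariety.IsIsogenous A B)
    (A : AbelianVariety ℂ) (hA : IsSmoothProjective A.dim A.X) (hCM : IsOfCMType A) :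
    ∃ v : PicardCM.Var, PicardCM.Var.IsCMAbelianVariety h₃ v ∧
      ∀ (F : Type) [Field F] [NumberField F] [IsCMField F], LeafEmbeddable F v →
        ∃ (n : ℕ) (Θ : Fin (n + 1) → CMType F), AVDominatedBy A (cmProdAV F h₃ n Θ) := by
  obtain ⟨v, B, hv, hB, hAB⟩ := hDom A hA hCM
  refine ⟨v, hv, fun F _ _ _ hF => ?_⟩
  obtain ⟨n, Θ, h⟩ := (coded_avDominatedBy hU h₃ hd hcor v hv hF B hB).1
  exact ⟨n, Θ, AVDominatedBy.of_isIsogenous hAB h⟩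

end Summit.HodgeConjecture.CorCM.Domination

end
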